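import Mathlib.Analysis.SpecialFunctions.SmoothTransition
import Mathlib.Analysis.SpecialFunctions.Pow.Integral
import Mathlib.Analysis.Calculus.BumpFunction.InnerProduct
import Mathlib.Analysis.Calculus.Deriv.Slope
import Literature.Analysis.FluidPDE.PineauVicolOneSlice
import Literature.Analysis.FluidPDE.ClassicalSuitableRegionEnergy
import HarnessLib

/-!
# Pineau–Vicol 2026, Theorem 1.9 — the printed proof: finite dissipation near the top

Analysis/FluidPDE proof file, third sibling of `PineauVicolOneSlice.lean` (the named fact
`Literature.Analysis.FluidPDE.pineauVicol2026_oneSlice_regularity`, B. Pineau, V. Vicol,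
arXiv:2607.09619 (2026), Thm. 1.9). In the proof of Proposition 9.5 (p. 33) the paper records
"By (1.15) and Lemma 9.2 we have `u ∈ L^∞_t L²_x(Q_{3/4})` and `∇u ∈ L²_{x,t}(Q_{3/4})`", the
second class through the pointwise Type I bounds for `∇u` of Lemma 9.2 (quantitative interior
regularity). This file obtains the class **`∇u ∈ L²(Q_{1/2})`** directly from the local energy
inequality — bypassing Lemma 9.2 — for the solutions of Theorem 1.9: a classical solution
`(u, p)` of Navier–Stokes (`ν = 1`, `f = 0`) on `[−1, 0) × B₁` with the Type I bound (1.15)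
and the pressure bound (1.16) on the annulus `A = {½ < |x| < ¾}` has
`∫∫_{Q_{1/2}} |∇u|² < ∞`, `Q_{1/2} = (−¼, 0) × B_{1/2}`
(`lintegral_parabolicCylinder_half_fderiv_lt_top`).

## Proof

`(u, p)` is a suitable weak solution on the open cylinder `O = (−1,0) × B₁`
(`IsClassicalNSSolutionOnRegion.isSuitableWeakSolutionOn`, `ClassicalSuitableRegionEnergy`);
its local energy inequality (CKN 1982, (2.5)) is tested with `φ_k(t, x) = χ_k(t) φ₁(x)`,
where `φ₁` is a smooth bump `= 1` on `B̄_{9/16}` supported in `B_{11/16}` (so that `∇φ₁`, `Δφ₁`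
live in the annulus `A`) and `χ_k(t) = ψ↑(t) ψ↓(kt)`, `ψ↑` a smooth step from `0` (`t ≤ −½`) to
`1` (`t ≥ −¼`), `ψ↓(s)` a smooth step from `1` (`s ≤ −2`) to `0` (`s ≥ −1`)
(Mathlib `Real.smoothTransition`). Since `ψ↓` is nonincreasing, `∂ₜφ_k ≤ φ₁ ψ↑' ≤ 4D`
uniformly in `k` (`D` a bound for `smoothTransition'`) — the energy leaving through the top has
the good sign — so the right-hand side
`∫∫ (|u|²(∂ₜφ_k + Δφ_k) + (|u|² + 2p) u·∇φ_k)` is bounded, uniformly in `k`, by the integrals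
of the Type I majorant `C_u²|x|⁻²` over `B_{11/16}` (integrable in `ℝ³`) and of the bounded
quantities `|u| ≤ 2C_u`, `|p| ≤ C_p` over the annulus. Hence `∫∫_{(−¼,−2/k) × B_{1/2}} |G|²`
is bounded uniformly in `k` for the weak gradient `G` of the local energy inequality, and by
monotone convergence and the a.e. uniqueness of weak spatial gradients
(`HasWeakSpatialGradientOn.ae_eq`, `G = Dₓu` a.e.) the claim follows.

## References

* B. Pineau, V. Vicol, arXiv:2607.09619 (2026), proof of Prop. 9.5 (p. 33), (1.15)–(1.16)
  (p. 8). [PineauVicol2026]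
* L. Caffarelli, R. Kohn, L. Nirenberg, Comm. Pure Appl. Math. 35 (1982), §2, (2.5).
  [CaffarelliKohnNirenberg1982]
-/

noncomputable section

open Set Metric Function Filter MeasureTheory TopologicalSpace
open _root_.Topology
open scoped ENNReal NNReal RealInnerProductSpace InnerProductSpace ContDiff Laplacian

namespace Literature.Analysis.FluidPDE

/-! ### One-dimensional smooth steps -/

section Steps

/-- The derivative of Mathlib's smooth transition function is bounded (it is continuous, and
vanishes off `[0, 1]` where the function is locally constant). [folklore] -/
theorem pvDiss_exists_abs_deriv_smoothTransition_le :
    ∃ D : ℝ, 0 ≤ D ∧ ∀ x, |deriv Real.smoothTransition x| ≤ D := by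
  have hc : Continuous (deriv Real.smoothTransition) :=
    (Real.smoothTransition.contDiff (n := 1)).continuous_deriv le_rfl
  obtain ⟨D, hD⟩ := isCompact_Icc.exists_bound_of_continuousOn (s := Icc (-1 : ℝ) 2) hc.continuousOn
  refine ⟨max D 0, le_max_right _ _, fun x => ?_⟩
  by_cases hx : x ∈ Icc (-1 : ℝ) 2
  · exact (hD x hx).trans (le_max_left _ _)
  · have h0 : deriv Real.smoothTransition x = 0 := by
      rw [mem_Icc, not_and_or, not_le, not_le] at hx
      rcases hx with hx | hx
      · have hev : Real.smoothTransition =ᶠ[𝓝 x] fun _ => (0 : ℝ) := by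
          filter_upwards [Iio_mem_nhds (show x < 0 by linarith)] with y hy
          exact Real.smoothTransition.zero_of_nonpos (le_of_lt hy)
        rw [hev.deriv_eq, deriv_const]
      · have hev : Real.smoothTransition =ᶠ[𝓝 x] fun _ => (1 : ℝ) := by
          filter_upwards [Ioi_mem_nhds (show 1 < x by linarith)] with y hy
          exact Real.smoothTransition.one_of_one_le (le_of_lt hy)
        rw [hev.deriv_eq, deriv_const]
    rw [h0, abs_zero]
    exact le_max_right _ _

/-- The smooth transition composed with an affine map is differentiable, with the chain-rule
derivative. [folklore] -/
theorem hasDerivAt_smoothTransition_comp_affine (a b x : ℝ) :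
    HasDerivAt (fun t => Real.smoothTransition (a * t + b))
      (deriv Real.smoothTransition (a * x + b) * a) x := by
  have h1 : HasDerivAt (fun t : ℝ => a * t + b) a x := by
    simpa using (hasDerivAt_id x).const_mul a |>.add_const b
  have h2 : HasDerivAt Real.smoothTransition (deriv Real.smoothTransition (a * x + b)) (a * x + b) :=
    ((Real.smoothTransition.contDiff (n := 1)).differentiable (by simp) _).hasDerivAt
  exact h2.comp x h1

/-- **The upward step** `ψ↑(t) = smoothTransition (4(t + ½))`: values in `[0,1]`, `= 0` for
`t ≤ −½`, `= 1` for `t ≥ −¼`, nondecreasing with `0 ≤ ψ↑' ≤ 4D`. [folklore] -/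
theorem pvDiss_stepUp_props :
    ∃ D : ℝ, 0 ≤ D ∧
      (∀ t : ℝ, 0 ≤ Real.smoothTransition (4 * t + 2)) ∧
      (∀ t : ℝ, Real.smoothTransition (4 * t + 2) ≤ 1) ∧
      (∀ t : ℝ, t ≤ -(1 / 2 : ℝ) → Real.smoothTransition (4 * t + 2) = 0) ∧
      (∀ t : ℝ, -(1 / 4 : ℝ) ≤ t → Real.smoothTransition (4 * t + 2) = 1) ∧
      (∀ t : ℝ, 0 ≤ deriv (fun s => Real.smoothTransition (4 * s + 2)) t) ∧
      (∀ t : ℝ, deriv (fun s => Real.smoothTransition (4 * s + 2)) t ≤ 4 * D) := by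
  obtain ⟨D, hD0, hD⟩ := pvDiss_exists_abs_deriv_smoothTransition_le
  have hmono : Monotone fun s : ℝ => Real.smoothTransition (4 * s + 2) :=
    Real.smoothTransition.monotone.comp fun a b hab => by linarith
  refine ⟨D, hD0, fun t => Real.smoothTransition.nonneg _, fun t => Real.smoothTransition.le_one _,
    fun t ht => Real.smoothTransition.zero_of_nonpos (by linarith),
    fun t ht => Real.smoothTransition.one_of_one_le (by linarith),
    fun t => hmono.deriv_nonneg, fun t => ?_⟩
  rw [(hasDerivAt_smoothTransition_comp_affine 4 2 t).deriv]
  have := (abs_le.1 (hD (4 * t + 2))).2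
  nlinarith

/-- **The downward step at rate `k`** `ψ↓_k(t) = smoothTransition (−kt − 1)` (`0 ≤ k`): values in
`[0,1]`, `= 1` for `t ≤ −2/k` (when `k > 0`), `= 0` for `t ≥ −1/k` and in particular for
`t ≥ 0`, nonincreasing with `ψ↓_k' ≤ 0`. [folklore] -/
theorem pvDiss_stepDown_props {k : ℝ} (hk : 0 ≤ k) :
    (∀ t : ℝ, 0 ≤ Real.smoothTransition (-k * t + -1)) ∧
      (∀ t : ℝ, Real.smoothTransition (-k * t + -1) ≤ 1) ∧
      (∀ t : ℝ, k * t ≤ -2 → Real.smoothTransition (-k * t + -1) = 1) ∧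
      (∀ t : ℝ, -1 ≤ k * t → Real.smoothTransition (-k * t + -1) = 0) ∧
      (∀ t : ℝ, deriv (fun s => Real.smoothTransition (-k * s + -1)) t ≤ 0) := by
  have hanti : Antitone fun s : ℝ => Real.smoothTransition (-k * s + -1) :=
    Real.smoothTransition.monotone.comp_antitone fun a b hab => by nlinarith
  exact ⟨fun t => Real.smoothTransition.nonneg _, fun t => Real.smoothTransition.le_one _,
    fun t ht => Real.smoothTransition.one_of_one_le (by linarith),
    fun t ht => Real.smoothTransition.zero_of_nonpos (by linarith),
    fun t => hanti.deriv_nonpos⟩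

/-- **The time cutoff `χ_k = ψ↑ · ψ↓_k`**: smooth, values in `[0,1]`, `χ_k(t) = 0` unless
`−½ < t < 0` (indeed unless `kt < −1`), `χ_k = 1` on `[−¼, −2/k]`, and — the point of the
construction — `χ_k' ≤ 4D` **uniformly in `k`** (the decreasing factor only helps). [folklore] -/
theorem pvDiss_timeCutoff_props :
    ∃ D : ℝ, 0 ≤ D ∧ ∀ k : ℝ, 0 ≤ k →
      ContDiff ℝ ∞ (fun t => Real.smoothTransition (4 * t + 2) * Real.smoothTransition (-k * t + -1)) ∧
      (∀ t, 0 ≤ Real.smoothTransition (4 * t + 2) * Real.smoothTransition (-k * t + -1)) ∧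
      (∀ t, Real.smoothTransition (4 * t + 2) * Real.smoothTransition (-k * t + -1) ≤ 1) ∧
      (∀ t, t ≤ -(1 / 2 : ℝ) →
        Real.smoothTransition (4 * t + 2) * Real.smoothTransition (-k * t + -1) = 0) ∧
      (∀ t, -1 ≤ k * t →
        Real.smoothTransition (4 * t + 2) * Real.smoothTransition (-k * t + -1) = 0) ∧
      (∀ t, -(1 / 4 : ℝ) ≤ t → k * t ≤ -2 →
        Real.smoothTransition (4 * t + 2) * Real.smoothTransition (-k * t + -1) = 1) ∧
      (∀ t, deriv (fun s => Real.smoothTransition (4 * s + 2) *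
        Real.smoothTransition (-k * s + -1)) t ≤ 4 * D) := by
  obtain ⟨D, hD0, hup0, hup1, hupz, hupo, hup'0, hup'D⟩ := pvDiss_stepUp_props
  refine ⟨D, hD0, fun k hk => ?_⟩
  obtain ⟨hdn0, hdn1, hdno, hdnz, hdn'⟩ := pvDiss_stepDown_props hk
  have hsm : ContDiff ℝ ∞ Real.smoothTransition := Real.smoothTransition.contDiff
  refine ⟨?_, fun t => mul_nonneg (hup0 t) (hdn0 t),
    fun t => mul_le_one₀ (hup1 t) (hdn0 t) (hdn1 t),
    fun t ht => by rw [hupz t ht, zero_mul], fun t ht => by rw [hdnz t ht, mul_zero],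
    fun t ht1 ht2 => by rw [hupo t ht1, hdno t ht2, mul_one], fun t => ?_⟩
  · exact (hsm.comp ((contDiff_const.mul contDiff_id).add contDiff_const)).mul
      (hsm.comp ((contDiff_const.mul contDiff_id).add contDiff_const))
  · have h1 := hasDerivAt_smoothTransition_comp_affine 4 2 t
    have h2 := hasDerivAt_smoothTransition_comp_affine (-k) (-1) t
    have h3 : HasDerivAt (fun s => Real.smoothTransition (4 * s + 2) *
        Real.smoothTransition (-k * s + -1))
        (deriv Real.smoothTransition (4 * t + 2) * 4 * Real.smoothTransition (-k * t + -1) +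
          Real.smoothTransition (4 * t + 2) * (deriv Real.smoothTransition (-k * t + -1) * -k)) t :=
      h1.mul h2
    rw [h3.deriv]
    have e1 : deriv Real.smoothTransition (4 * t + 2) * 4 =
        deriv (fun s => Real.smoothTransition (4 * s + 2)) t := by rw [h1.deriv]
    have e2 : deriv Real.smoothTransition (-k * t + -1) * -k =
        deriv (fun s => Real.smoothTransition (-k * s + -1)) t := by rw [h2.deriv]
    rw [e1, e2]
    have a1 := hup'D t
    have a2 := hup'0 t
    have a3 := hdn' t
    have a4 := hup0 t
    have a5 := hdn1 t
    have a6 := hdn0 t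
    nlinarith [mul_le_mul_of_nonneg_left a5 a2, mul_nonpos_of_nonneg_of_nonpos a4 a3]

end Steps

/-! ### The space bump and the space–time test functions -/

section TestFunctions

/-- `∇(c f)(x) = c ∇f(x)` at a point of differentiability (real scalars). [folklore] -/
theorem gradient_const_mul_of_differentiableAt {E : Type*} [NormedAddCommGroup E]
    [InnerProductSpace ℝ E] [CompleteSpace E] {f : E → ℝ} {x : E} (hf : DifferentiableAt ℝ f x)
    (c : ℝ) : gradient (fun y => c * f y) x = c • gradient f x := by
  have h1 : (fun y => c * f y) = fun y => c • f y := rfl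
  rw [h1]
  simp only [gradient, fderiv_fun_const_smul hf, map_smulₛₗ, starRingEnd_apply, star_trivial]

/-- **A smooth bump on `ℝ³`, `= 1` on `B̄_{9/16}`, supported in `B̄_{11/16}`, with bounded
gradient and Laplacian supported in the shell `9/16 ≤ |x| ≤ 11/16`.** [folklore] -/
theorem pvDiss_exists_spaceBump :
    ∃ φ₁ : EuclideanSpace ℝ (Fin 3) → ℝ, ∃ M₁ M₂ : ℝ, 0 ≤ M₁ ∧ 0 ≤ M₂ ∧
      ContDiff ℝ ∞ φ₁ ∧ HasCompactSupport φ₁ ∧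
      tsupport φ₁ = closedBall (0 : EuclideanSpace ℝ (Fin 3)) (11 / 16) ∧
      (∀ x, 0 ≤ φ₁ x) ∧ (∀ x, φ₁ x ≤ 1) ∧
      (∀ x ∈ closedBall (0 : EuclideanSpace ℝ (Fin 3)) (9 / 16), φ₁ x = 1) ∧
      (∀ x, ‖gradient φ₁ x‖ ≤ M₁) ∧ (∀ x, |(Δ φ₁) x| ≤ M₂) ∧
      (∀ x, x ∉ closedBall (0 : EuclideanSpace ℝ (Fin 3)) (11 / 16) \ ball 0 (9 / 16) →
        gradient φ₁ x = 0 ∧ (Δ φ₁) x = 0) := by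
  set b : ContDiffBump (0 : EuclideanSpace ℝ (Fin 3)) := ⟨9 / 16, 11 / 16, by norm_num, by norm_num⟩
    with hb
  have hcd : ContDiff ℝ ∞ b := b.contDiff
  have hcs : HasCompactSupport b := b.hasCompactSupport
  have hts : tsupport b = closedBall (0 : EuclideanSpace ℝ (Fin 3)) (11 / 16) := b.tsupport_eq
  -- gradient: continuous with compact support, hence bounded
  have hgc : Continuous (gradient b) := continuous_gradient_of_contDiff (hcd.of_le (WithTop.coe_le_coe.2 le_top))
  have hgs : HasCompactSupport (gradient (b : EuclideanSpace ℝ (Fin 3) → ℝ)) := by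
    have h1 : HasCompactSupport (fderiv ℝ (b : EuclideanSpace ℝ (Fin 3) → ℝ)) := hcs.fderiv (𝕜 := ℝ)
    exact h1.comp_left (g := fun L => (InnerProductSpace.toDual ℝ (EuclideanSpace ℝ (Fin 3))).symm L)
      (map_zero _)
  obtain ⟨M₁, hM₁⟩ := hgc.bounded_above_of_compact_support hgs
  -- Laplacian: continuous with compact support, hence bounded
  have hlc : Continuous (Δ (b : EuclideanSpace ℝ (Fin 3) → ℝ)) :=
    continuous_laplacian (hcd.of_le (WithTop.coe_le_coe.2 le_top))
  have hls : HasCompactSupport (Δ (b : EuclideanSpace ℝ (Fin 3) → ℝ)) := by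
    refine HasCompactSupport.intro (K := tsupport b) hcs fun x hx => ?_
    exact laplacian_eq_zero_of_notMem_tsupport hx
  obtain ⟨M₂, hM₂⟩ := hlc.bounded_above_of_compact_support hls
  refine ⟨b, max M₁ 0, max M₂ 0, le_max_right _ _, le_max_right _ _, hcd, hcs, hts,
    fun x => b.nonneg, fun x => b.le_one, fun x hx => b.one_of_mem_closedBall (by simpa [hb] using hx),
    fun x => (hM₁ x).trans (le_max_left _ _),
    fun x => (Real.norm_eq_abs _ ▸ hM₂ x).trans (le_max_left _ _), fun x hx => ?_⟩
  rw [Set.mem_sdiff, not_and_or, not_not] at hx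
  rcases hx with hx | hx
  · -- off the support
    have hx' : x ∉ tsupport b := by rwa [hts]
    exact ⟨gradient_eq_zero_of_notMem_tsupport hx', laplacian_eq_zero_of_notMem_tsupport hx'⟩
  · -- inside the ball where `b = 1`
    have hev : (b : EuclideanSpace ℝ (Fin 3) → ℝ) =ᶠ[𝓝 x] fun _ => 1 :=
      b.eventuallyEq_one_of_mem_ball (by simpa [hb] using hx)
    refine ⟨?_, ?_⟩
    · rw [gradient, hev.fderiv_eq]
      simp
    · rw [(InnerProductSpace.laplacian_congr_nhds hev).eq_of_nhds]
      simp

/-- **The test functions `φ_k(t, x) = χ_k(t) φ₁(x)` of the local energy inequality.** For every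
`k ≥ 4` there is a test function `φ` on the open cylinder `O = (−1, 0) × B₁` with values in
`[0,1]`, `φ = 1` on `[−¼, −2/k] × B̄_{1/2}`, whose time derivative is bounded ABOVE by
`4D · 𝟙_{[−½,0) × B̄_{11/16}}` uniformly in `k`, and whose spatial gradient and Laplacian are
bounded by `M₁`, `M₂` and supported in `[−½, 0) × {9/16 ≤ |x| ≤ 11/16}` (inside the annulus of
(1.16)). [folklore] -/
theorem exists_pvTestFunction :
    ∃ D M₁ M₂ : ℝ, 0 ≤ D ∧ 0 ≤ M₁ ∧ 0 ≤ M₂ ∧ ∀ k : ℕ, 4 ≤ k →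
      ∃ φ : ℝ → EuclideanSpace ℝ (Fin 3) → ℝ,
        IsSpaceTimeTestOn ⟨Ioo (-1 : ℝ) 0 ×ˢ ball (0 : EuclideanSpace ℝ (Fin 3)) 1,
          isOpen_Ioo.prod isOpen_ball⟩ φ ∧
        (∀ t x, 0 ≤ φ t x) ∧ (∀ t x, φ t x ≤ 1) ∧
        (∀ t ∈ Icc (-(1 / 4 : ℝ)) (-(2 / (k : ℝ))),
          ∀ x ∈ closedBall (0 : EuclideanSpace ℝ (Fin 3)) (1 / 2), φ t x = 1) ∧
        (∀ t x, timeDeriv φ t x ≤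
          4 * D * (Ico (-(1 / 2 : ℝ)) 0 ×ˢ closedBall (0 : EuclideanSpace ℝ (Fin 3)) (11 / 16)).indicator
            (fun _ => (1 : ℝ)) (t, x)) ∧
        (∀ t x, |(Δ (φ t)) x| ≤
          M₂ * (Ico (-(1 / 2 : ℝ)) 0 ×ˢ (closedBall (0 : EuclideanSpace ℝ (Fin 3)) (11 / 16) \
            ball 0 (9 / 16))).indicator (fun _ => (1 : ℝ)) (t, x)) ∧
        (∀ t x, ‖gradient (φ t) x‖ ≤
          M₁ * (Ico (-(1 / 2 : ℝ)) 0 ×ˢ (closedBall (0 : EuclideanSpace ℝ (Fin 3)) (11 / 16) \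
            ball 0 (9 / 16))).indicator (fun _ => (1 : ℝ)) (t, x)) := by
  obtain ⟨D, hD0, hχ⟩ := pvDiss_timeCutoff_props
  obtain ⟨φ₁, M₁, M₂, hM₁0, hM₂0, hφs, hφc, hφts, hφ0, hφ1, hφone, hφg, hφl, hφz⟩ := pvDiss_exists_spaceBump
  refine ⟨D, M₁, M₂, hD0, hM₁0, hM₂0, fun k hk => ?_⟩
  have hk0 : (0 : ℝ) < k := by exact_mod_cast (show 0 < k by omega)
  have hkr : (4 : ℝ) ≤ k := by exact_mod_cast hk
  obtain ⟨hχs, hχ0, hχ1, hχz1, hχz2, hχone, hχ'⟩ := hχ (k : ℝ) hk0.le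
  -- abbreviation for the time cutoff
  set χ : ℝ → ℝ := fun t => Real.smoothTransition (4 * t + 2) *
    Real.smoothTransition (-(k : ℝ) * t + -1) with hχ_def
  set φ : ℝ → EuclideanSpace ℝ (Fin 3) → ℝ := fun t x => χ t * φ₁ x with hφ_def
  -- time localisation of `χ`
  have hχ_zero_of_le : ∀ t, t ≤ -(1 / 2 : ℝ) → χ t = 0 := hχz1
  have hχ_zero_of_ge : ∀ t, -(1 / (k : ℝ)) ≤ t → χ t = 0 := fun t ht => by
    refine hχz2 t ?_
    have : -(1 : ℝ) ≤ (k : ℝ) * t := by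
      have h := mul_le_mul_of_nonneg_left ht hk0.le
      have e : (k : ℝ) * -(1 / (k : ℝ)) = -1 := by field_simp
      linarith [e ▸ h]
    exact this
  -- the compact set carrying the support
  set K : Set (ℝ × EuclideanSpace ℝ (Fin 3)) :=
    Icc (-(1 / 2 : ℝ)) (-(1 / (k : ℝ))) ×ˢ closedBall (0 : EuclideanSpace ℝ (Fin 3)) (11 / 16) with hK
  have hKc : IsCompact K := isCompact_Icc.prod (isCompact_closedBall _ _)
  have hsuppK : support (uncurry φ) ⊆ K := by
    rintro ⟨t, x⟩ hz
    rw [mem_support] at hz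
    have hz' : χ t * φ₁ x ≠ 0 := hz
    have hχt : χ t ≠ 0 := left_ne_zero_of_mul hz'
    have hφx : φ₁ x ≠ 0 := right_ne_zero_of_mul hz'
    refine mk_mem_prod ⟨?_, ?_⟩ ?_
    · by_contra h
      exact hχt (hχ_zero_of_le t (le_of_lt (not_le.1 h)))
    · by_contra h
      exact hχt (hχ_zero_of_ge t (le_of_lt (not_le.1 h)))
    · have : x ∈ tsupport φ₁ := subset_tsupport _ (mem_support.2 hφx)
      rwa [hφts] at this
  have htsupp : tsupport (uncurry φ) ⊆ K :=
    closure_minimal hsuppK (hKc.isClosed)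
  have hKO : K ⊆ Ioo (-1 : ℝ) 0 ×ˢ ball (0 : EuclideanSpace ℝ (Fin 3)) 1 := by
    refine prod_mono (fun t ht => ⟨by linarith [ht.1], ?_⟩) (closedBall_subset_ball (by norm_num))
    have : -(1 / (k : ℝ)) < 0 := by
      have : (0 : ℝ) < 1 / (k : ℝ) := by positivity
      linarith
    linarith [ht.2]
  have htest : IsSpaceTimeTestOn ⟨Ioo (-1 : ℝ) 0 ×ˢ ball (0 : EuclideanSpace ℝ (Fin 3)) 1,
      isOpen_Ioo.prod isOpen_ball⟩ φ := by
    refine ⟨?_, HasCompactSupport.intro' hKc hKc.isClosed fun z hz => ?_, htsupp.trans hKO⟩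
    · exact (hχs.comp contDiff_fst).mul (hφs.comp contDiff_snd)
    · by_contra h
      exact hz (hsuppK (mem_support.2 h))
  refine ⟨φ, htest, fun t x => mul_nonneg (hχ0 t) (hφ0 x),
    fun t x => mul_le_one₀ (hχ1 t) (hφ0 x) (hφ1 x), fun t ht x hx => ?_, fun t x => ?_,
    fun t x => ?_, fun t x => ?_⟩
  · -- `φ = 1` on `[−1/4, −2/k] × B̄_{1/2}`
    have h1 : χ t = 1 := hχone t ht.1 (by
      have h := mul_le_mul_of_nonneg_left ht.2 hk0.le
      have e : (k : ℝ) * -(2 / (k : ℝ)) = -2 := by field_simp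
      linarith [e ▸ h])
    have h2 : φ₁ x = 1 := hφone x (closedBall_subset_closedBall (by norm_num) hx)
    show χ t * φ₁ x = 1
    rw [h1, h2, mul_one]
  · -- the time derivative
    have hd : timeDeriv φ t x = deriv χ t * φ₁ x := by
      rw [timeDeriv_apply]
      show deriv (fun s => χ s * φ₁ x) t = deriv χ t * φ₁ x
      exact deriv_mul_const_field (φ₁ x)
    rw [hd]
    by_cases hz : (t, x) ∈ Ico (-(1 / 2 : ℝ)) 0 ×ˢ closedBall (0 : EuclideanSpace ℝ (Fin 3)) (11 / 16)
    · rw [indicator_of_mem hz, mul_one]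
      calc deriv χ t * φ₁ x ≤ 4 * D * φ₁ x := mul_le_mul_of_nonneg_right (hχ' t) (hφ0 x)
        _ ≤ 4 * D * 1 := by gcongr; exact hφ1 x
        _ = 4 * D := mul_one _
    · rw [indicator_of_notMem hz, mul_zero]
      rw [mem_prod, not_and_or] at hz
      rcases hz with ht | hx
      · -- `χ` vanishes near `t`
        have h0 : deriv χ t = 0 := by
          rw [mem_Ico, not_and_or, not_le, not_lt] at ht
          rcases ht with ht | ht
          · have hev : χ =ᶠ[𝓝 t] fun _ => 0 := by
              filter_upwards [Iio_mem_nhds ht] with s hs using hχ_zero_of_le s hs.le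
            rw [hev.deriv_eq, deriv_const]
          · have hev : χ =ᶠ[𝓝 t] fun _ => 0 := by
              have hlt : -(1 / (k : ℝ)) < t := lt_of_lt_of_le (by
                have : (0 : ℝ) < 1 / (k : ℝ) := by positivity
                linarith) ht
              filter_upwards [Ioi_mem_nhds hlt] with s hs using hχ_zero_of_ge s hs.le
            rw [hev.deriv_eq, deriv_const]
        rw [h0, zero_mul]
      · have h0 : φ₁ x = 0 := by
          have : x ∉ tsupport φ₁ := by rwa [hφts]
          exact image_eq_zero_of_notMem_tsupport this
        rw [h0, mul_zero]
  · -- the Laplacian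
    have hL : (Δ (φ t)) x = χ t * (Δ φ₁) x := by
      have e : φ t = χ t • φ₁ := by funext y; rfl
      rw [e, InnerProductSpace.laplacian_smul _ (hφs.contDiffAt.of_le (WithTop.coe_le_coe.2 le_top)),
        smul_eq_mul]
    rw [hL, abs_mul]
    by_cases hz : (t, x) ∈ Ico (-(1 / 2 : ℝ)) 0 ×ˢ (closedBall (0 : EuclideanSpace ℝ (Fin 3)) (11 / 16) \
        ball 0 (9 / 16))
    · rw [indicator_of_mem hz, mul_one]
      calc |χ t| * |(Δ φ₁) x| ≤ 1 * M₂ := by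
            gcongr
            · rw [abs_of_nonneg (hχ0 t)]; exact hχ1 t
            · exact hφl x
        _ = M₂ := one_mul _
    · rw [indicator_of_notMem hz, mul_zero]
      rw [mem_prod, not_and_or] at hz
      rcases hz with ht | hx
      · have h0 : χ t = 0 := by
          rw [mem_Ico, not_and_or, not_le, not_lt] at ht
          rcases ht with ht | ht
          · exact hχ_zero_of_le t ht.le
          · exact hχ_zero_of_ge t (le_trans (by
              have : (0 : ℝ) < 1 / (k : ℝ) := by positivity
              linarith) ht)
        rw [h0, abs_zero, zero_mul]
      · rw [(hφz x hx).2, abs_zero, mul_zero]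
  · -- the gradient
    have hG : gradient (φ t) x = χ t • gradient φ₁ x := by
      show gradient (fun y => χ t * φ₁ y) x = χ t • gradient φ₁ x
      exact gradient_const_mul_of_differentiableAt
        ((hφs.differentiable (by simp)).differentiableAt) (χ t)
    rw [hG, norm_smul, Real.norm_eq_abs]
    by_cases hz : (t, x) ∈ Ico (-(1 / 2 : ℝ)) 0 ×ˢ (closedBall (0 : EuclideanSpace ℝ (Fin 3)) (11 / 16) \
        ball 0 (9 / 16))
    · rw [indicator_of_mem hz, mul_one]
      calc |χ t| * ‖gradient φ₁ x‖ ≤ 1 * M₁ := by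
            gcongr
            · rw [abs_of_nonneg (hχ0 t)]; exact hχ1 t
            · exact hφg x
        _ = M₁ := one_mul _
    · rw [indicator_of_notMem hz, mul_zero]
      rw [mem_prod, not_and_or] at hz
      rcases hz with ht | hx
      · have h0 : χ t = 0 := by
          rw [mem_Ico, not_and_or, not_le, not_lt] at ht
          rcases ht with ht | ht
          · exact hχ_zero_of_le t ht.le
          · exact hχ_zero_of_ge t (le_trans (by
              have : (0 : ℝ) < 1 / (k : ℝ) := by positivity
              linarith) ht)
        rw [h0, abs_zero, zero_mul]
      · rw [(hφz x hx).1, norm_zero, mul_zero]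

end TestFunctions

/-! ### Tools for the energy estimate -/

section Tools

/-- Upper bounds pass to Bochner integrals without integrability of the smaller function: if
`f ≤ g` a.e., `g` integrable and nonnegative, then `∫ f ≤ ∫ g` (if `f` is not integrable its
integral is `0 ≤ ∫ g`). [folklore] -/
theorem integral_le_of_ae_le_of_nonneg {X : Type*} [MeasurableSpace X] {μ : Measure X}
    {f g : X → ℝ} (hg : Integrable g μ) (hg0 : ∀ x, 0 ≤ g x) (hfg : f ≤ᵐ[μ] g) :
    ∫ x, f x ∂μ ≤ ∫ x, g x ∂μ := by
  by_cases hf : Integrable f μ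
  · exact integral_mono_ae hf hg hfg
  · rw [integral_undef hf]
    exact integral_nonneg hg0

variable {u : ℝ → EuclideanSpace ℝ (Fin 3) → EuclideanSpace ℝ (Fin 3)}
  {p : ℝ → EuclideanSpace ℝ (Fin 3) → ℝ} {Cu Cp : ℝ}

/-- The Type I constant of (1.15) is nonnegative (test at `(t, x) = (−½, 0)`). [folklore] -/
theorem typeI_const_nonneg
    (hI : ∀ t ∈ Ico (-1 : ℝ) 0, ∀ x ∈ ball (0 : EuclideanSpace ℝ (Fin 3)) 1,
      ‖u t x‖ ≤ Cu / (Real.sqrt (-t) + ‖x‖)) : 0 ≤ Cu := by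
  have h := hI (-(1 / 2 : ℝ)) ⟨by norm_num, by norm_num⟩ 0 (mem_ball_self one_pos)
  rw [norm_zero, add_zero] at h
  have hs : 0 < Real.sqrt (-(-(1 / 2 : ℝ))) := Real.sqrt_pos.2 (by norm_num)
  have h0 : 0 ≤ Cu / Real.sqrt (-(-(1 / 2 : ℝ))) := (norm_nonneg _).trans h
  exact (div_nonneg_iff.1 h0).elim (fun h => h.1) fun h => absurd h.2 (not_le.2 hs)

/-- The pressure constant of (1.16) is nonnegative (test at a point of the annulus). [folklore] -/
theorem pressure_const_nonneg
    (hP : ∀ t ∈ Ico (-1 : ℝ) 0, ∀ x : EuclideanSpace ℝ (Fin 3),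
      1 / 2 < ‖x‖ → ‖x‖ < 3 / 4 → |p t x| ≤ Cp) : 0 ≤ Cp := by
  obtain ⟨x, hx⟩ : ∃ x : EuclideanSpace ℝ (Fin 3), ‖x‖ = 5 / 8 :=
    exists_norm_eq _ (by norm_num)
  exact (abs_nonneg _).trans (hP (-(1 / 2 : ℝ)) ⟨by norm_num, by norm_num⟩ x (by rw [hx]; norm_num)
    (by rw [hx]; norm_num))

/-- **Type I majorant, squared**: under (1.15), for `t ∈ [−1, 0)` and `0 ≠ x ∈ B₁`,
`‖u(t, x)‖² ≤ C_u² |x|⁻²`. [cite: PineauVicol2026, (1.15), arXiv:2607.09619 p. 8] -/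
theorem norm_sq_le_of_typeI
    (hI : ∀ t ∈ Ico (-1 : ℝ) 0, ∀ x ∈ ball (0 : EuclideanSpace ℝ (Fin 3)) 1,
      ‖u t x‖ ≤ Cu / (Real.sqrt (-t) + ‖x‖))
    {t : ℝ} (ht : t ∈ Ico (-1 : ℝ) 0) {x : EuclideanSpace ℝ (Fin 3)} (hx : x ∈ ball 0 1)
    (hx0 : x ≠ 0) : ‖u t x‖ ^ 2 ≤ Cu ^ 2 * ‖x‖ ^ (-(2 : ℝ)) := by
  have hCu := typeI_const_nonneg hI
  have h1 := hI t ht x hx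
  have hxpos : 0 < ‖x‖ := norm_pos_iff.2 hx0
  have h2 : ‖u t x‖ ≤ Cu / ‖x‖ :=
    h1.trans (div_le_div_of_nonneg_left hCu hxpos (by linarith [Real.sqrt_nonneg (-t)]))
  have e : (Cu / ‖x‖) ^ 2 = Cu ^ 2 * ‖x‖ ^ (-(2 : ℝ)) := by
    rw [Real.rpow_neg (norm_nonneg _), Real.rpow_two, div_pow, div_eq_mul_inv]
  rw [← e]
  exact pow_le_pow_left₀ (norm_nonneg _) h2 2

/-- **Type I bound on the annulus**: for `t ∈ [−1, 0)` and `9/16 ≤ |x| ≤ 11/16`,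
`‖u(t, x)‖ ≤ 2C_u`. [cite: PineauVicol2026, (1.15), arXiv:2607.09619 p. 8] -/
theorem norm_le_two_mul_of_typeI
    (hI : ∀ t ∈ Ico (-1 : ℝ) 0, ∀ x ∈ ball (0 : EuclideanSpace ℝ (Fin 3)) 1,
      ‖u t x‖ ≤ Cu / (Real.sqrt (-t) + ‖x‖))
    {t : ℝ} (ht : t ∈ Ico (-1 : ℝ) 0) {x : EuclideanSpace ℝ (Fin 3)} (hx1 : 9 / 16 ≤ ‖x‖)
    (hx2 : ‖x‖ ≤ 11 / 16) : ‖u t x‖ ≤ 2 * Cu := by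
  have hCu := typeI_const_nonneg hI
  have hx : x ∈ ball (0 : EuclideanSpace ℝ (Fin 3)) 1 := by
    rw [mem_ball_zero_iff]; linarith
  have h1 := hI t ht x hx
  have hden : (1 / 2 : ℝ) ≤ Real.sqrt (-t) + ‖x‖ := by linarith [Real.sqrt_nonneg (-t)]
  calc ‖u t x‖ ≤ Cu / (Real.sqrt (-t) + ‖x‖) := h1
    _ ≤ Cu / (1 / 2) := div_le_div_of_nonneg_left hCu (by norm_num) hden
    _ = 2 * Cu := by ring

/-- **The spatial majorant of the energy estimate is integrable**: for constants `a, b ≥ 0`, the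
function `𝟙_{B₁}(x) (a C_u² |x|⁻² + b)` is integrable on `ℝ³` (`|x|⁻²` is integrable on balls
of `ℝ³`, Mathlib `integrableOn_ball_of_norm_le_rpow`), and its integral is nonnegative.
[folklore] -/
theorem integrable_energyMajorant (a b Cu : ℝ) (ha : 0 ≤ a) (hb : 0 ≤ b) :
    Integrable ((ball (0 : EuclideanSpace ℝ (Fin 3)) 1).indicator
      fun x => a * (Cu ^ 2 * ‖x‖ ^ (-(2 : ℝ))) + b) volume ∧
    0 ≤ ∫ x, (ball (0 : EuclideanSpace ℝ (Fin 3)) 1).indicator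
      (fun x => a * (Cu ^ 2 * ‖x‖ ^ (-(2 : ℝ))) + b) x := by
  have h1 : IntegrableOn (fun x : EuclideanSpace ℝ (Fin 3) => a * (Cu ^ 2 * ‖x‖ ^ (-(2 : ℝ))))
      (ball 0 1) volume := by
    refine integrableOn_ball_of_norm_le_rpow (by rw [finrank_euclideanSpace_fin]; norm_num)
      (C := a * Cu ^ 2) (α := 2) (by rw [finrank_euclideanSpace_fin]; norm_num)
      (Eventually.of_forall fun y => ?_) ?_
    · rw [Real.norm_of_nonneg (by positivity)]; ring_nf; exact le_rfl
    · exact (((continuous_norm.measurable.pow_const _).const_mul _).const_mul _).aestronglyMeasurable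
  have h2 : IntegrableOn (fun _ : EuclideanSpace ℝ (Fin 3) => b) (ball (0 : EuclideanSpace ℝ (Fin 3)) 1)
      volume := integrableOn_const measure_ball_lt_top.ne
  refine ⟨(integrable_indicator_iff measurableSet_ball).2 (h1.add h2),
    integral_nonneg fun x => ?_⟩
  by_cases hx : x ∈ ball (0 : EuclideanSpace ℝ (Fin 3)) 1
  · rw [indicator_of_mem hx]; positivity
  · rw [indicator_of_notMem hx]; exact le_rfl

end Tools

/-! ### The right-hand side of the local energy inequality is bounded uniformly -/

section RHS

variable {u : ℝ → EuclideanSpace ℝ (Fin 3) → EuclideanSpace ℝ (Fin 3)}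
  {p : ℝ → EuclideanSpace ℝ (Fin 3) → ℝ} {Cu Cp : ℝ}

/-- An indicator with value `1` is at most `1`. [folklore] -/
theorem indicator_one_le_one {X : Type*} (s : Set X) (z : X) :
    s.indicator (fun _ => (1 : ℝ)) z ≤ 1 := by
  by_cases hz : z ∈ s
  · rw [indicator_of_mem hz]
  · rw [indicator_of_notMem hz]; exact zero_le_one

/-- **Uniform bound for the right-hand side of the local energy inequality** (the analytic
heart of this file). Under (1.15)–(1.16), for a test function `φ` with values in `[0, 1]`,
`∂ₜφ ≤ 4D 𝟙_{[−½,0) × B̄_{11/16}}`, `|Δφ| ≤ M₂ 𝟙_{[−½,0) × shell}`, `|∇φ| ≤ M₁ 𝟙_{[−½,0) × shell}`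
(shell `= {9/16 ≤ |x| ≤ 11/16}`), the CKN right-hand side
`∫∫ (|u|²(∂ₜφ + Δφ) + (|u|² + 2p) u·∇φ)` is at most
`½ ∫_{B₁} ((4D + M₂) C_u² |x|⁻² + S₀) dx`, `S₀ = ((2C_u)² + 2C_p)(2C_u) M₁` — a bound which does not
see `φ` any more (in particular not the rate at which `φ` is switched off near the top: that part
of `∂ₜφ` is nonpositive). Pointwise majorisation by the Type I majorant on `B₁` (a.e., off the
origin) and by the annulus bounds, integrated first in `x` then in `t ∈ [−½, 0)`; slices whose
integrand is not integrable contribute `0`. [cite: PineauVicol2026, proof of Prop. 9.5 with (1.15)–(1.16), arXiv:2607.09619 p. 33] -/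
theorem pv_energyRHS_le
    (hI : ∀ t ∈ Ico (-1 : ℝ) 0, ∀ x ∈ ball (0 : EuclideanSpace ℝ (Fin 3)) 1,
      ‖u t x‖ ≤ Cu / (Real.sqrt (-t) + ‖x‖))
    (hP : ∀ t ∈ Ico (-1 : ℝ) 0, ∀ x : EuclideanSpace ℝ (Fin 3),
      1 / 2 < ‖x‖ → ‖x‖ < 3 / 4 → |p t x| ≤ Cp)
    {D M₁ M₂ : ℝ} (hD0 : 0 ≤ D) (hM₁0 : 0 ≤ M₁) (hM₂0 : 0 ≤ M₂)
    {φ : ℝ → EuclideanSpace ℝ (Fin 3) → ℝ}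
    (hT4 : ∀ t x, timeDeriv φ t x ≤
      4 * D * (Ico (-(1 / 2 : ℝ)) 0 ×ˢ closedBall (0 : EuclideanSpace ℝ (Fin 3)) (11 / 16)).indicator
        (fun _ => (1 : ℝ)) (t, x))
    (hT5 : ∀ t x, |(Δ (φ t)) x| ≤
      M₂ * (Ico (-(1 / 2 : ℝ)) 0 ×ˢ (closedBall (0 : EuclideanSpace ℝ (Fin 3)) (11 / 16) \
        ball 0 (9 / 16))).indicator (fun _ => (1 : ℝ)) (t, x))
    (hT6 : ∀ t x, ‖gradient (φ t) x‖ ≤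
      M₁ * (Ico (-(1 / 2 : ℝ)) 0 ×ˢ (closedBall (0 : EuclideanSpace ℝ (Fin 3)) (11 / 16) \
        ball 0 (9 / 16))).indicator (fun _ => (1 : ℝ)) (t, x)) :
    ∫ t, ∫ x, (‖u t x‖ ^ 2 * (timeDeriv φ t x + 1 * Δ (φ t) x) +
        (‖u t x‖ ^ 2 + 2 * p t x) * ⟪u t x, gradient (φ t) x⟫ +
        2 * ⟪(0 : ℝ → EuclideanSpace ℝ (Fin 3) → EuclideanSpace ℝ (Fin 3)) t x, u t x⟫ * φ t x) ≤
      1 / 2 * ∫ x, (ball (0 : EuclideanSpace ℝ (Fin 3)) 1).indicator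
        (fun x => (4 * D + M₂) * (Cu ^ 2 * ‖x‖ ^ (-(2 : ℝ))) +
          ((2 * Cu) ^ 2 + 2 * Cp) * (2 * Cu) * M₁) x := by
  have hCu : 0 ≤ Cu := typeI_const_nonneg hI
  have hCp : 0 ≤ Cp := pressure_const_nonneg hP
  set S₀ : ℝ := ((2 * Cu) ^ 2 + 2 * Cp) * (2 * Cu) * M₁ with hS₀
  have hS₀0 : 0 ≤ S₀ := by positivity
  set g : EuclideanSpace ℝ (Fin 3) → ℝ := (ball (0 : EuclideanSpace ℝ (Fin 3)) 1).indicator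
    fun x => (4 * D + M₂) * (Cu ^ 2 * ‖x‖ ^ (-(2 : ℝ))) + S₀ with hg
  obtain ⟨hgi, hgint0⟩ := integrable_energyMajorant (4 * D + M₂) S₀ Cu (by positivity) hS₀0
  have hg0 : ∀ x, 0 ≤ g x := fun x => by
    by_cases hx : x ∈ ball (0 : EuclideanSpace ℝ (Fin 3)) 1
    · rw [hg, indicator_of_mem hx]; positivity
    · rw [hg, indicator_of_notMem hx]
  -- names for the sets
  set T : Set (ℝ × EuclideanSpace ℝ (Fin 3)) :=
    Ico (-(1 / 2 : ℝ)) 0 ×ˢ closedBall (0 : EuclideanSpace ℝ (Fin 3)) (11 / 16) with hT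
  set Sh : Set (ℝ × EuclideanSpace ℝ (Fin 3)) :=
    Ico (-(1 / 2 : ℝ)) 0 ×ˢ (closedBall (0 : EuclideanSpace ℝ (Fin 3)) (11 / 16) \ ball 0 (9 / 16))
    with hSh
  have hShT : Sh ⊆ T := prod_mono Subset.rfl sdiff_subset
  -- the integrand
  set R : ℝ → EuclideanSpace ℝ (Fin 3) → ℝ := fun t x =>
    ‖u t x‖ ^ 2 * (timeDeriv φ t x + 1 * Δ (φ t) x) +
      (‖u t x‖ ^ 2 + 2 * p t x) * ⟪u t x, gradient (φ t) x⟫ +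
      2 * ⟪(0 : ℝ → EuclideanSpace ℝ (Fin 3) → EuclideanSpace ℝ (Fin 3)) t x, u t x⟫ * φ t x
    with hR
  -- off `T`, the integrand is nonpositive
  have hpt_out : ∀ t x, (t, x) ∉ T → R t x ≤ 0 := by
    intro t x hz
    have hzS : (t, x) ∉ Sh := fun h => hz (hShT h)
    have h1 : timeDeriv φ t x ≤ 0 := by
      have := hT4 t x
      rwa [indicator_of_notMem hz, mul_zero] at this
    have h2 : (Δ (φ t)) x = 0 := by
      have := hT5 t x
      rw [indicator_of_notMem hzS, mul_zero] at this
      exact abs_nonpos_iff.1 this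
    have h3 : gradient (φ t) x = 0 := by
      have := hT6 t x
      rw [indicator_of_notMem hzS, mul_zero] at this
      exact norm_le_zero_iff.1 this
    simp only [hR, h2, h3, mul_zero, add_zero, inner_zero_right, Pi.zero_apply,
      inner_zero_left, zero_mul]
    exact mul_nonpos_of_nonneg_of_nonpos (sq_nonneg _) h1
  -- on `T` (off the origin), the integrand is below the majorant
  have hpt_in : ∀ t ∈ Ico (-(1 / 2 : ℝ)) 0, ∀ x ∈ ball (0 : EuclideanSpace ℝ (Fin 3)) 1,
      x ≠ 0 → R t x ≤ g x := by
    intro t ht x hxb hx0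
    have ht' : t ∈ Ico (-1 : ℝ) 0 := ⟨by linarith [ht.1], ht.2⟩
    have hu2 : ‖u t x‖ ^ 2 ≤ Cu ^ 2 * ‖x‖ ^ (-(2 : ℝ)) := norm_sq_le_of_typeI hI ht' hxb hx0
    have hTd : timeDeriv φ t x ≤ 4 * D :=
      (hT4 t x).trans (mul_le_of_le_one_right (by positivity) (indicator_one_le_one _ _))
    have hL : (Δ (φ t)) x ≤ M₂ :=
      (le_abs_self _).trans ((hT5 t x).trans (mul_le_of_le_one_right hM₂0 (indicator_one_le_one _ _)))
    have term1 : ‖u t x‖ ^ 2 * (timeDeriv φ t x + 1 * Δ (φ t) x) ≤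
        (4 * D + M₂) * (Cu ^ 2 * ‖x‖ ^ (-(2 : ℝ))) :=
      calc ‖u t x‖ ^ 2 * (timeDeriv φ t x + 1 * Δ (φ t) x)
          ≤ ‖u t x‖ ^ 2 * (4 * D + M₂) :=
            mul_le_mul_of_nonneg_left (by linarith) (sq_nonneg _)
        _ = (4 * D + M₂) * ‖u t x‖ ^ 2 := by ring
        _ ≤ (4 * D + M₂) * (Cu ^ 2 * ‖x‖ ^ (-(2 : ℝ))) :=
            mul_le_mul_of_nonneg_left hu2 (by positivity)
    have term2 : (‖u t x‖ ^ 2 + 2 * p t x) * ⟪u t x, gradient (φ t) x⟫ ≤ S₀ := by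
      by_cases hsh : (t, x) ∈ Sh
      · obtain ⟨-, hxs⟩ := mem_prod.1 hsh
        have hx1 : 9 / 16 ≤ ‖x‖ := by
          have := hxs.2
          rwa [mem_ball_zero_iff, not_lt] at this
        have hx2 : ‖x‖ ≤ 11 / 16 := by
          have := hxs.1
          rwa [mem_closedBall_zero_iff] at this
        have hux : ‖u t x‖ ≤ 2 * Cu := norm_le_two_mul_of_typeI hI ht' hx1 hx2
        have hpx : |p t x| ≤ Cp := hP t ht' x (by linarith) (by linarith)
        have hgx : ‖gradient (φ t) x‖ ≤ M₁ :=
          (hT6 t x).trans (mul_le_of_le_one_right hM₁0 (indicator_one_le_one _ _))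
        have h₁ : ‖u t x‖ ^ 2 + 2 * |p t x| ≤ (2 * Cu) ^ 2 + 2 * Cp :=
          add_le_add (pow_le_pow_left₀ (norm_nonneg _) hux 2) (by linarith)
        have h₂ : ‖u t x‖ * ‖gradient (φ t) x‖ ≤ 2 * Cu * M₁ :=
          mul_le_mul hux hgx (norm_nonneg _) (by positivity)
        calc (‖u t x‖ ^ 2 + 2 * p t x) * ⟪u t x, gradient (φ t) x⟫
            ≤ |(‖u t x‖ ^ 2 + 2 * p t x) * ⟪u t x, gradient (φ t) x⟫| := le_abs_self _
          _ = |‖u t x‖ ^ 2 + 2 * p t x| * |⟪u t x, gradient (φ t) x⟫| := abs_mul _ _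
          _ ≤ (‖u t x‖ ^ 2 + 2 * |p t x|) * (‖u t x‖ * ‖gradient (φ t) x‖) := by
              refine mul_le_mul ?_ (abs_real_inner_le_norm _ _) (abs_nonneg _) (by positivity)
              calc |‖u t x‖ ^ 2 + 2 * p t x| ≤ |‖u t x‖ ^ 2| + |2 * p t x| := abs_add_le _ _
                _ = ‖u t x‖ ^ 2 + 2 * |p t x| := by
                    rw [abs_of_nonneg (sq_nonneg _), abs_mul, abs_two]
          _ ≤ ((2 * Cu) ^ 2 + 2 * Cp) * (2 * Cu * M₁) :=
              mul_le_mul h₁ h₂ (by positivity) (by positivity)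
          _ = S₀ := by rw [hS₀]; ring
      · have hg0' : gradient (φ t) x = 0 := by
          have := hT6 t x
          rw [indicator_of_notMem hsh, mul_zero] at this
          exact norm_le_zero_iff.1 this
        rw [hg0', inner_zero_right, mul_zero]
        exact hS₀0
    have term3 : 2 * ⟪(0 : ℝ → EuclideanSpace ℝ (Fin 3) → EuclideanSpace ℝ (Fin 3)) t x, u t x⟫ *
        φ t x = 0 := by simp
    rw [hg, indicator_of_mem hxb]
    show R t x ≤ (4 * D + M₂) * (Cu ^ 2 * ‖x‖ ^ (-(2 : ℝ))) + S₀
    rw [hR]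
    simp only []
    linarith [term1, term2, term3]
  -- the slices
  have hF : ∀ t, ∫ x, R t x ≤ (Ico (-(1 / 2 : ℝ)) 0).indicator (fun _ => ∫ x, g x) t := by
    intro t
    by_cases ht : t ∈ Ico (-(1 / 2 : ℝ)) 0
    · rw [indicator_of_mem ht]
      refine integral_le_of_ae_le_of_nonneg hgi hg0 ?_
      have h0 : ∀ᵐ x ∂(volume : Measure (EuclideanSpace ℝ (Fin 3))), x ≠ 0 := by
        rw [ae_iff]; simp
      filter_upwards [h0] with x hx0
      by_cases hxb : x ∈ ball (0 : EuclideanSpace ℝ (Fin 3)) 1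
      · exact hpt_in t ht x hxb hx0
      · have hz : (t, x) ∉ T := fun h =>
          hxb (closedBall_subset_ball (by norm_num) (mem_prod.1 h).2)
        rw [hg, indicator_of_notMem hxb]
        exact hpt_out t x hz
    · rw [indicator_of_notMem ht]
      exact integral_nonpos fun x => hpt_out t x fun h => ht (mem_prod.1 h).1
  -- integrate in time
  have hvol : volume (Ico (-(1 / 2 : ℝ)) 0) = ENNReal.ofReal (1 / 2) := by
    rw [Real.volume_Ico]; norm_num
  have hh : Integrable ((Ico (-(1 / 2 : ℝ)) 0).indicator fun _ => ∫ x, g x) volume := by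
    refine (integrable_indicator_iff measurableSet_Ico).2 (integrableOn_const ?_)
    rw [hvol]; exact ENNReal.ofReal_ne_top
  have hh0 : ∀ t, 0 ≤ (Ico (-(1 / 2 : ℝ)) 0).indicator (fun _ => ∫ x, g x) t := fun t => by
    by_cases ht : t ∈ Ico (-(1 / 2 : ℝ)) 0
    · rw [indicator_of_mem ht]; exact hgint0
    · rw [indicator_of_notMem ht]
  calc ∫ t, ∫ x, R t x ≤ ∫ t, (Ico (-(1 / 2 : ℝ)) 0).indicator (fun _ => ∫ x, g x) t :=
        integral_le_of_ae_le_of_nonneg hh hh0 (Eventually.of_forall hF)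
    _ = 1 / 2 * ∫ x, g x := by
        rw [integral_indicator_const _ measurableSet_Ico, Measure.real, hvol,
          ENNReal.toReal_ofReal (by norm_num), smul_eq_mul]

end RHS

/-! ### Finite dissipation on `Q_{1/2}` -/

section Main

variable {u : ℝ → EuclideanSpace ℝ (Fin 3) → EuclideanSpace ℝ (Fin 3)}
  {p : ℝ → EuclideanSpace ℝ (Fin 3) → ℝ} {Cu Cp : ℝ}

/-- The cylinder `Q_{1/2} = (−¼, 0) × B_{1/2}` as an increasing union of the cylinders
`(−¼, −2/(k+4)) × B_{1/2}` on which the test functions equal `1`. [folklore] -/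
theorem parabolicCylinder_half_eq_iUnion :
    parabolicCylinder (1 / 2 : ℝ) (0 : ℝ × EuclideanSpace ℝ (Fin 3)) =
      ⋃ k : ℕ, Ioo (-(1 / 4 : ℝ)) (-(2 / ((k + 4 : ℕ) : ℝ))) ×ˢ
        ball (0 : EuclideanSpace ℝ (Fin 3)) (1 / 2) := by
  ext ⟨t, x⟩
  simp only [mem_parabolicCylinder, mem_iUnion, mem_prod, mem_Ioo, mem_ball, Prod.fst_zero,
    Prod.snd_zero]
  constructor
  · rintro ⟨⟨h1, h2⟩, h3⟩
    obtain ⟨k, hk⟩ := exists_nat_gt (2 / (-t))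
    refine ⟨k, ⟨⟨by linarith, ?_⟩, h3⟩⟩
    have hk' : (0 : ℝ) < ((k + 4 : ℕ) : ℝ) := by positivity
    have hnt : 0 < -t := by linarith
    have hkt : 2 / (-t) < ((k + 4 : ℕ) : ℝ) := hk.trans (by push_cast; linarith)
    rw [div_lt_iff₀ hnt] at hkt
    have : 2 / ((k + 4 : ℕ) : ℝ) < -t := by
      rw [div_lt_iff₀ hk']; linarith
    linarith
  · rintro ⟨k, ⟨⟨h1, h2⟩, h3⟩⟩
    have hk' : (0 : ℝ) < ((k + 4 : ℕ) : ℝ) := by positivity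
    have : (0 : ℝ) < 2 / ((k + 4 : ℕ) : ℝ) := by positivity
    exact ⟨⟨by linarith, by linarith⟩, h3⟩

/-- **Finite dissipation near the top for the solutions of Theorem 1.9.** For a classical
solution `(u, p)` of Navier–Stokes (`ν = 1`, `f = 0`) on `[−1,0) × B₁` with the Type I bound
(1.15) and the annular pressure bound (1.16), `∫∫_{Q_{1/2}} |∇u|² < ∞`,
`Q_{1/2} = (−¼, 0) × B_{1/2}` — the class "`∇u ∈ L²_{x,t}`" of the proof of Prop. 9.5 (there
via Lemma 9.2, here from the local energy inequality of the suitable weak solution `(u, p)` on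
the open cylinder, tested against `φ_k = χ_k φ₁`, with the uniform bound `pv_energyRHS_le`,
monotone convergence in `k`, and the a.e. uniqueness of weak spatial gradients).
[cite: PineauVicol2026, proof of Prop. 9.5, arXiv:2607.09619 p. 33] -/
theorem lintegral_parabolicCylinder_half_fderiv_lt_top
    (hreg : IsClassicalNSSolutionOnRegion
      (Ico (-1 : ℝ) 0 ×ˢ ball (0 : EuclideanSpace ℝ (Fin 3)) 1) 1 0 u p)
    (hI : ∀ t ∈ Ico (-1 : ℝ) 0, ∀ x ∈ ball (0 : EuclideanSpace ℝ (Fin 3)) 1,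
      ‖u t x‖ ≤ Cu / (Real.sqrt (-t) + ‖x‖))
    (hP : ∀ t ∈ Ico (-1 : ℝ) 0, ∀ x : EuclideanSpace ℝ (Fin 3),
      1 / 2 < ‖x‖ → ‖x‖ < 3 / 4 → |p t x| ≤ Cp) :
    ∫⁻ w in parabolicCylinder (1 / 2 : ℝ) (0 : ℝ × EuclideanSpace ℝ (Fin 3)),
      ENNReal.ofReal (frobeniusNormSq (fderiv ℝ (u w.1) w.2)) < ⊤ := by
  have hOo : IsOpen (Ioo (-1 : ℝ) 0 ×ˢ ball (0 : EuclideanSpace ℝ (Fin 3)) 1) :=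
    isOpen_Ioo.prod isOpen_ball
  have hOm : MeasurableSet (Ioo (-1 : ℝ) 0 ×ˢ ball (0 : EuclideanSpace ℝ (Fin 3)) 1) :=
    hOo.measurableSet
  have hcl : IsClassicalNSSolutionOnRegion (Ioo (-1 : ℝ) 0 ×ˢ ball (0 : EuclideanSpace ℝ (Fin 3)) 1)
      1 0 u p := hreg.mono_of_isOpen (prod_mono Ioo_subset_Ico_self Subset.rfl) hOo
  have hsuit := hcl.isSuitableWeakSolutionOn hOo one_pos
  obtain ⟨G, hG, hG2, hLEI⟩ := hsuit.localEnergy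
  obtain ⟨D, M₁, M₂, hD0, hM₁0, hM₂0, hφk⟩ := exists_pvTestFunction
  set B : ℝ := 1 / 2 * ∫ x, (ball (0 : EuclideanSpace ℝ (Fin 3)) 1).indicator
    (fun x => (4 * D + M₂) * (Cu ^ 2 * ‖x‖ ^ (-(2 : ℝ))) +
      ((2 * Cu) ^ 2 + 2 * Cp) * (2 * Cu) * M₁) x with hB
  -- measurability of `|G|²` on the open cylinder
  have hGm : AEStronglyMeasurable (fun z : ℝ × EuclideanSpace ℝ (Fin 3) => frobeniusNormSq (G z.1 z.2))
      (volume.restrict (Ioo (-1 : ℝ) 0 ×ˢ ball (0 : EuclideanSpace ℝ (Fin 3)) 1)) :=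
    LerayHopfProofs.continuous_frobeniusNormSq.comp_aestronglyMeasurable
      hG.locallyIntegrableOn_grad.aestronglyMeasurable
  -- Step 1: uniform bound on the cylinders where the test functions equal `1`
  have hstep : ∀ k : ℕ, 4 ≤ k →
      ∫⁻ z in Ioo (-(1 / 4 : ℝ)) (-(2 / (k : ℝ))) ×ˢ ball (0 : EuclideanSpace ℝ (Fin 3)) (1 / 2),
        ENNReal.ofReal (frobeniusNormSq (G z.1 z.2)) ≤ ENNReal.ofReal (B / 2) := by
    intro k hk
    obtain ⟨φ, htest, hφ0, hφ1, hφone, hT4, hT5, hT6⟩ := hφk k hk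
    have hle := hLEI φ htest hφ0
    have hrhs := pv_energyRHS_le hI hP hD0 hM₁0 hM₂0 hT4 hT5 hT6
    have hI2 : ∫ t, ∫ x, frobeniusNormSq (G t x) * φ t x ≤ B / 2 := by
      rw [hB]; linarith
    -- the integrand `I = |G|² φ`, supported in `K = tsupport φ ⊆ O`
    set K : Set (ℝ × EuclideanSpace ℝ (Fin 3)) := tsupport (uncurry φ) with hK
    have hKc : IsCompact K := htest.hasCompactSupport
    have hKO : K ⊆ Ioo (-1 : ℝ) 0 ×ˢ ball (0 : EuclideanSpace ℝ (Fin 3)) 1 := htest.tsupport_subset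
    set I : ℝ × EuclideanSpace ℝ (Fin 3) → ℝ := fun z => frobeniusNormSq (G z.1 z.2) * φ z.1 z.2
      with hI_def
    have hφc : Continuous fun z : ℝ × EuclideanSpace ℝ (Fin 3) => φ z.1 z.2 :=
      htest.contDiff.continuous
    have hI0 : ∀ z, 0 ≤ I z := fun z => mul_nonneg (frobeniusNormSq_nonneg _) (hφ0 z.1 z.2)
    have hIK : ∀ z ∉ K, I z = 0 := fun z hz => by
      have : φ z.1 z.2 = 0 := (image_eq_zero_of_notMem_tsupport hz : uncurry φ z = 0)
      rw [hI_def]; simp only [this, mul_zero]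
    -- integrability of `𝟙_K |G|²`
    have hGK : IntegrableOn (fun z : ℝ × EuclideanSpace ℝ (Fin 3) => frobeniusNormSq (G z.1 z.2)) K
        volume := by
      refine ⟨hGm.mono_measure (Measure.restrict_mono hKO le_rfl), ?_⟩
      rw [HasFiniteIntegral]
      calc ∫⁻ z in K, ‖frobeniusNormSq (G z.1 z.2)‖ₑ
          = ∫⁻ z in K, ENNReal.ofReal (frobeniusNormSq (G z.1 z.2)) :=
            lintegral_congr fun z => Real.enorm_eq_ofReal (frobeniusNormSq_nonneg _)
        _ < ⊤ := hG2 K hKO hKc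
    -- measurability and integrability of `I`
    have hIm : AEStronglyMeasurable I volume := by
      have h1 : AEStronglyMeasurable I
          (volume.restrict (Ioo (-1 : ℝ) 0 ×ˢ ball (0 : EuclideanSpace ℝ (Fin 3)) 1)) :=
        hGm.mul (hφc.aestronglyMeasurable.restrict)
      have h2 : I = (Ioo (-1 : ℝ) 0 ×ˢ ball (0 : EuclideanSpace ℝ (Fin 3)) 1).indicator I := by
        funext z
        by_cases hz : z ∈ Ioo (-1 : ℝ) 0 ×ˢ ball (0 : EuclideanSpace ℝ (Fin 3)) 1
        · rw [indicator_of_mem hz]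
        · rw [indicator_of_notMem hz, hIK z fun h => hz (hKO h)]
      rw [h2]
      exact (aestronglyMeasurable_indicator_iff hOm).2 h1
    have hIint : Integrable I volume := by
      refine Integrable.mono' ((integrable_indicator_iff hKc.measurableSet).2 hGK) hIm
        (Eventually.of_forall fun z => ?_)
      by_cases hz : z ∈ K
      · rw [indicator_of_mem hz, Real.norm_of_nonneg (hI0 z), hI_def]
        exact mul_le_of_le_one_right (frobeniusNormSq_nonneg _) (hφ1 z.1 z.2)
      · rw [indicator_of_notMem hz, hIK z hz, norm_zero]
    -- the iterated integral of the local energy inequality is the integral of `I`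
    have hprod : ∫ z, I z = ∫ t, ∫ x, frobeniusNormSq (G t x) * φ t x := by
      have hIint' : Integrable I ((volume : Measure ℝ).prod (volume : Measure (EuclideanSpace ℝ (Fin 3)))) := by
        rw [← Measure.volume_eq_prod]; exact hIint
      rw [Measure.volume_eq_prod, integral_prod _ hIint']
    have hlint : ∫⁻ z, ENNReal.ofReal (I z) = ENNReal.ofReal (∫ z, I z) :=
      (ofReal_integral_eq_lintegral_ofReal hIint (Eventually.of_forall hI0)).symm
    -- on the cylinder where `φ = 1`, `I = |G|²`
    have hone : ∀ z ∈ Ioo (-(1 / 4 : ℝ)) (-(2 / (k : ℝ))) ×ˢ ball (0 : EuclideanSpace ℝ (Fin 3)) (1 / 2),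
        ENNReal.ofReal (frobeniusNormSq (G z.1 z.2)) = ENNReal.ofReal (I z) := by
      intro z hz
      obtain ⟨ht, hx⟩ := mem_prod.1 hz
      have h1 : φ z.1 z.2 = 1 := hφone z.1 (Ioo_subset_Icc_self ht) z.2 (ball_subset_closedBall hx)
      rw [hI_def]; simp only [h1, mul_one]
    calc ∫⁻ z in Ioo (-(1 / 4 : ℝ)) (-(2 / (k : ℝ))) ×ˢ ball (0 : EuclideanSpace ℝ (Fin 3)) (1 / 2),
          ENNReal.ofReal (frobeniusNormSq (G z.1 z.2))
        = ∫⁻ z in Ioo (-(1 / 4 : ℝ)) (-(2 / (k : ℝ))) ×ˢ ball (0 : EuclideanSpace ℝ (Fin 3)) (1 / 2),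
            ENNReal.ofReal (I z) :=
          setLIntegral_congr_fun (measurableSet_Ioo.prod measurableSet_ball) hone
      _ ≤ ∫⁻ z, ENNReal.ofReal (I z) := setLIntegral_le_lintegral _ _
      _ = ENNReal.ofReal (∫ z, I z) := hlint
      _ ≤ ENNReal.ofReal (B / 2) := by rw [hprod]; exact ENNReal.ofReal_le_ofReal hI2
  -- Step 2: monotone convergence over the exhaustion of `Q_{1/2}`
  have hdir : Directed (· ⊆ ·) fun k : ℕ =>
      Ioo (-(1 / 4 : ℝ)) (-(2 / ((k + 4 : ℕ) : ℝ))) ×ˢ ball (0 : EuclideanSpace ℝ (Fin 3)) (1 / 2) := by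
    refine Monotone.directed_le fun k k' hkk' => prod_mono (Ioo_subset_Ioo le_rfl ?_) Subset.rfl
    have h1 : (0 : ℝ) < ((k + 4 : ℕ) : ℝ) := by positivity
    have h2 : ((k + 4 : ℕ) : ℝ) ≤ ((k' + 4 : ℕ) : ℝ) := by exact_mod_cast Nat.add_le_add_right hkk' 4
    have : 2 / ((k' + 4 : ℕ) : ℝ) ≤ 2 / ((k + 4 : ℕ) : ℝ) :=
      div_le_div_of_nonneg_left (by norm_num) h1 h2
    linarith
  have hGfin : ∫⁻ z in parabolicCylinder (1 / 2 : ℝ) (0 : ℝ × EuclideanSpace ℝ (Fin 3)),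
      ENNReal.ofReal (frobeniusNormSq (G z.1 z.2)) ≤ ENNReal.ofReal (B / 2) := by
    rw [parabolicCylinder_half_eq_iUnion, setLIntegral_iUnion_of_directed _ hdir]
    exact iSup_le fun k => hstep (k + 4) (by omega)
  -- Step 3: the weak gradient of the local energy inequality is the classical one, a.e.
  have hGcl := hcl.hasWeakSpatialGradientOn hOo
    (Q := ⟨Ioo (-1 : ℝ) 0 ×ˢ ball (0 : EuclideanSpace ℝ (Fin 3)) 1, hOo⟩) Subset.rfl
  have hae := hG.ae_eq hGcl
  have hsub : parabolicCylinder (1 / 2 : ℝ) (0 : ℝ × EuclideanSpace ℝ (Fin 3)) ⊆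
      Ioo (-1 : ℝ) 0 ×ˢ ball (0 : EuclideanSpace ℝ (Fin 3)) 1 := by
    intro w hw
    rw [mem_parabolicCylinder] at hw
    simp only [Prod.fst_zero, Prod.snd_zero, dist_zero_right] at hw
    exact mk_mem_prod ⟨by nlinarith [hw.1.1], hw.1.2⟩ (mem_ball_zero_iff.2 (by linarith [hw.2]))
  have hae' : ∀ᵐ z ∂(volume.restrict (parabolicCylinder (1 / 2 : ℝ) (0 : ℝ × EuclideanSpace ℝ (Fin 3)))),
      ENNReal.ofReal (frobeniusNormSq (fderiv ℝ (u z.1) z.2)) =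
        ENNReal.ofReal (frobeniusNormSq (G z.1 z.2)) := by
    filter_upwards [ae_restrict_of_ae_restrict_of_subset hsub hae] with z hz
    have hz' : G z.1 z.2 = fderiv ℝ (u z.1) z.2 := hz
    rw [hz']
  calc ∫⁻ w in parabolicCylinder (1 / 2 : ℝ) (0 : ℝ × EuclideanSpace ℝ (Fin 3)),
        ENNReal.ofReal (frobeniusNormSq (fderiv ℝ (u w.1) w.2))
      = ∫⁻ w in parabolicCylinder (1 / 2 : ℝ) (0 : ℝ × EuclideanSpace ℝ (Fin 3)),
          ENNReal.ofReal (frobeniusNormSq (G w.1 w.2)) := lintegral_congr_ae hae'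
    _ ≤ ENNReal.ofReal (B / 2) := hGfin
    _ < ⊤ := ENNReal.ofReal_lt_top

end Main





end Literature.Analysis.FluidPDE

end
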